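import Literature.Topology.FourManifolds.TimeDependentFlow
import HarnessLib

/-!
# A compactly supported vector field generates an ambient isotopy (Hirsch 1976, Ch. 8 §1, Thm. 1.2)

Topic `Literature/Topology/FourManifolds`; the autonomous case of M. W. Hirsch, *Differential
Topology* (1976), Ch. 8 §1, Thm. 1.2: *"A time-dependent vector field which has compact support
generates an isotopy"*, on an arbitrary Hausdorff manifold without boundary (not necessarily
compact) — the tree's `exists_ambientIsotopy_of_timeDependent` (`TimeDependentFlow.lean`) being
the case of a compact manifold and a time-dependent field, and `flowIsotopy` (`ChartFieldFlow.lean`)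
the autonomous case on a compact manifold. Written for the fact seat
`provefact-Literature.Topology.FourManifolds.FramedLink.IsStrictHandleSlide.slideModel` (Kirby
(1989), Ch. I §4): the model of the handle slide across the core of the new solid torus is the
flow of a compactly supported field on the (non-compact) tube `S¹ × ℝ²`. Everything here is
proved.

* `Literature.Topology.FourManifolds.hasUniformLocalFlow_of_isCompact_support` — a smooth vector
  field vanishing off a compact closed set `S` has uniform local flows
  (`Literature.Topology.FourManifolds.HasUniformLocalFlow`): finitely many smooth local flows
  (`exists_contMDiffOn_localFlow`, `FlowsProofs.lean`) cover `S`, and off `S` the constant curves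
  are integral curves. Hirsch's "compact support gives bounded velocity".
* `Literature.Topology.FourManifolds.uflowStage`, `Literature.Topology.FourManifolds.uflowIsotopy`
  — the global flow (`uflow`, with its group law and joint smoothness, `TimeDependentFlow.lean`)
  packaged as stage diffeomorphisms and as an `AmbientIsotopy`; `isMIntegralCurve_uflowIsotopy`
  (the flow equation), `uflowIsotopy_apply_of_eq_zero` (zeros of the field do not move),
  `uflowIsotopy_eqOn_of_isMIntegralCurveOn` (an explicit integral curve through `x` on an
  interval is the track of `x` there — how the flow is computed where the field is explicit).

## References

* M. W. Hirsch, *Differential Topology*, GTM 33, Springer (1976), Ch. 8 §1, Thms. 1.1–1.2.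
  [cite: HirschDT1976, Ch. 8 §1, Thms. 1.1–1.2]
* J. M. Lee, *Introduction to Smooth Manifolds*, 2nd ed., GTM 218 (2012), Thm. 9.12, Lemma 9.15,
  Thm. 9.16 (compactly supported fields are complete). [LeeSmoothManifolds2013]
-/

open scoped Manifold ContDiff Topology
open Set Function Filter

noncomputable section

namespace Literature.Topology.FourManifolds

universe u

variable {E : Type u} [NormedAddCommGroup E] [NormedSpace ℝ E]
  {H : Type*} [TopologicalSpace H] {I : ModelWithCorners ℝ E H}
  {P : Type*} [TopologicalSpace P] [ChartedSpace H P] [IsManifold I ∞ P]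
  [T2Space P] [BoundarylessManifold I P]
  {V : Π x : P, TangentSpace I x} {ε : ℝ}

/-! ### Uniform local flows from compact support -/

omit [T2Space P] in
/-- **A compactly supported vector field has uniform local flows** (Hirsch (1976), Ch. 8 §1,
Thm. 1.2: compact support gives bounded velocity; Lee (2012), Thm. 9.16): if the smooth field `V`
vanishes off the compact closed set `S`, finitely many smooth local flows
(`exists_contMDiffOn_localFlow`) cover `S`, and on the open set `P ∖ S` the constant curves are
integral curves; the minimum of the finitely many times of existence is a uniform time.
[cite: HirschDT1976, Ch. 8 §1, Thms. 1.1–1.2] -/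
theorem hasUniformLocalFlow_of_isCompact_support [CompleteSpace E]
    (hV : ContMDiff I I.tangent ∞ fun x => (⟨x, V x⟩ : TangentBundle I P))
    {S : Set P} (hS : IsCompact S) (hSc : IsClosed S) (hVS : ∀ x, x ∉ S → V x = 0) :
    ∃ ε > (0 : ℝ), HasUniformLocalFlow I V ε := by
  classical
  have hloc : ∀ p : P, ∃ U : Set P, IsOpen U ∧ p ∈ U ∧ ∃ ε > (0 : ℝ), ∃ Φ : P → ℝ → P,
      (∀ x ∈ U, Φ x 0 = x) ∧ (∀ x ∈ U, IsMIntegralCurveOn (Φ x) V (Ioo (-ε) ε)) ∧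
      ContMDiffOn (I.prod 𝓘(ℝ, ℝ)) I ∞ (fun q : P × ℝ => Φ q.1 q.2) (U ×ˢ Ioo (-ε) ε) :=
    fun p => exists_contMDiffOn_localFlow hV BoundarylessManifold.isInteriorPoint
  choose U hUo hpU δ hδ Φ hΦ0 hΦc hΦs using hloc
  obtain ⟨T, hT⟩ := hS.elim_finite_subcover U hUo fun x _ => mem_iUnion.2 ⟨x, hpU x⟩
  -- a uniform time `ε₀ ≤ 1`, below all the `δ i`, `i ∈ T`
  obtain ⟨ε₀, hε₀, -, hε₀T⟩ : ∃ ε₀ : ℝ, 0 < ε₀ ∧ ε₀ ≤ 1 ∧ ∀ i ∈ T, ε₀ ≤ δ i := by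
    rcases T.eq_empty_or_nonempty with hTe | hTne
    · exact ⟨1, one_pos, le_rfl, fun i hi => by simp [hTe] at hi⟩
    · refine ⟨min 1 (T.inf' hTne δ), lt_min one_pos ((Finset.lt_inf'_iff hTne).2 fun i _ => hδ i),
        min_le_left _ _, fun i hi => (min_le_right _ _).trans (Finset.inf'_le _ hi)⟩
  refine ⟨ε₀, hε₀, fun x₀ => ?_⟩
  by_cases hxS : x₀ ∈ S
  · obtain ⟨i, hi, hx₀i⟩ := mem_iUnion₂.1 (hT hxS)
    have hIoo : Ioo (-ε₀) ε₀ ⊆ Ioo (-δ i) (δ i) := fun t ht =>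
      ⟨lt_of_le_of_lt (neg_le_neg (hε₀T i hi)) ht.1, lt_of_lt_of_le ht.2 (hε₀T i hi)⟩
    exact ⟨U i, hUo i, hx₀i, Φ i, hΦ0 i, fun x hx => (hΦc i x hx).mono hIoo,
      (hΦs i).mono (prod_mono Subset.rfl hIoo)⟩
  · -- off the support: constant curves
    exact ⟨Sᶜ, hSc.isOpen_compl, hxS, fun x _ => x, fun x _ => rfl,
      fun x hx => (isMIntegralCurve_const (v := V) (hVS x hx)).isMIntegralCurveOn _,
      contMDiff_fst.contMDiffOn⟩

/-! ### The generated ambient isotopy -/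

section Flow

variable (hV : ContMDiff I I.tangent ∞ fun x => (⟨x, V x⟩ : TangentBundle I P))
  (hε : 0 < ε) (hu : HasUniformLocalFlow I V ε)
include hV hε hu

/-- **The stages of the flow are diffeomorphisms**: `x ↦ uflow x t` with inverse `x ↦ uflow x (-t)`
(group law, `uflow_neg_uflow`; smoothness `contMDiff_uflow_apply`). Lee (2012), Thm. 9.12.
[cite: HirschDT1976, Ch. 8 §1, Thm. 1.1] -/
def uflowStage (t : ℝ) : P ≃ₘ^∞⟮I, I⟯ P where
  toFun x := uflow hV hε hu x t
  invFun x := uflow hV hε hu x (-t)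
  left_inv x := uflow_neg_uflow hV hε hu x t
  right_inv x := uflow_uflow_neg hV hε hu x t
  contMDiff_toFun := contMDiff_uflow_apply hV hε hu t
  contMDiff_invFun := contMDiff_uflow_apply hV hε hu (-t)

/-- The stage as a function. [folklore] -/
@[simp] theorem coe_uflowStage (t : ℝ) : ⇑(uflowStage hV hε hu t) = fun x => uflow hV hε hu x t :=
  rfl

/-- **The ambient isotopy generated by a complete vector field** (the flow `uflow` of a smooth
field with uniform local flows, e.g. a compactly supported one,
`hasUniformLocalFlow_of_isCompact_support`): jointly smooth (`contMDiff_uflow`), each stage a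
diffeomorphism (`uflowStage`), the identity at time `0`. Hirsch (1976), Ch. 8 §1, Thm. 1.2.
[cite: HirschDT1976, Ch. 8 §1, Thms. 1.1–1.2] -/
def uflowIsotopy : AmbientIsotopy I P where
  toFun t := ⇑(uflowStage hV hε hu t)
  contMDiff := contMDiff_uflow hV hε hu
  bijective t := (uflowStage hV hε hu t).bijective
  isLocalDiffeomorph t := (uflowStage hV hε hu t).isLocalDiffeomorph
  map_zero := by
    funext x
    simp only [coe_uflowStage, uflow_zero, id_eq]

/-- Stages of the generated isotopy. [folklore] -/
@[simp] theorem uflowIsotopy_toFun (t : ℝ) (x : P) :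
    (uflowIsotopy hV hε hu).toFun t x = uflow hV hε hu x t := rfl

/-- **The flow equation**: every track `t ↦ Ψ_t x` is an integral curve of `V` on `ℝ`.
[cite: HirschDT1976, Ch. 8 §1, Thm. 1.1] -/
theorem isMIntegralCurve_uflowIsotopy (x : P) :
    IsMIntegralCurve (fun t => (uflowIsotopy hV hε hu).toFun t x) V :=
  isMIntegralCurve_uflow hV hε hu x

/-- **Zeros of the field do not move.** [folklore] -/
theorem uflowIsotopy_apply_of_eq_zero {x : P} (hx : V x = 0) (t : ℝ) :
    (uflowIsotopy hV hε hu).toFun t x = x := by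
  have hγ : IsMIntegralCurve (fun _ : ℝ => x) V := isMIntegralCurve_const hx
  have h := congrFun (eq_uflow_of_isMIntegralCurve hV hε hu hγ) t
  exact h.symm

/-- **The flow is the explicit integral curve where one is known**: if `γ` is an integral curve of
`V` on an open interval `(a, b) ∋ 0` with `γ 0 = x`, then `Ψ_t x = γ t` for `t ∈ (a, b)`
(uniqueness of integral curves). [cite: LeeSmoothManifolds2013, Thm. 9.12 (a)] -/
theorem uflowIsotopy_eqOn_of_isMIntegralCurveOn {γ : ℝ → P} {a b : ℝ} (h0 : (0 : ℝ) ∈ Ioo a b)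
    (hγ : IsMIntegralCurveOn γ V (Ioo a b)) {t : ℝ} (ht : t ∈ Ioo a b) :
    (uflowIsotopy hV hε hu).toFun t (γ 0) = γ t :=
  (eqOn_uflow_of_isMIntegralCurveOn hV hε hu h0 hγ ht).symm

/-- The stages of the flow are the identity off any closed set outside which the field vanishes
(compact support: the isotopy has support in `S`). [cite: HirschDT1976, Ch. 8 §1, Thm. 1.2] -/
theorem uflowIsotopy_apply_of_not_mem {S : Set P} (hVS : ∀ x, x ∉ S → V x = 0) {x : P}
    (hx : x ∉ S) (t : ℝ) : (uflowIsotopy hV hε hu).toFun t x = x :=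
  uflowIsotopy_apply_of_eq_zero hV hε hu (hVS x hx) t

end Flow

/-- **A compactly supported vector field generates an ambient isotopy** (Hirsch (1976), Ch. 8
§1, Thm. 1.2, autonomous case, on a Hausdorff manifold without boundary): there is an ambient
isotopy `Ψ` whose tracks are the integral curves of `V` and whose stages are the identity off the
support. [cite: HirschDT1976, Ch. 8 §1, Thms. 1.1–1.2] -/
theorem exists_ambientIsotopy_of_isCompact_support [CompleteSpace E]
    (hV : ContMDiff I I.tangent ∞ fun x => (⟨x, V x⟩ : TangentBundle I P))
    {S : Set P} (hS : IsCompact S) (hVS : ∀ x, x ∉ S → V x = 0) :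
    ∃ Ψ : AmbientIsotopy I P, (∀ x, IsMIntegralCurve (fun t => Ψ.toFun t x) V) ∧
      ∀ x, x ∉ S → ∀ t, Ψ.toFun t x = x := by
  obtain ⟨ε, hε, hu⟩ := hasUniformLocalFlow_of_isCompact_support hV hS hS.isClosed hVS
  exact ⟨uflowIsotopy hV hε hu, isMIntegralCurve_uflowIsotopy hV hε hu,
    fun x hx t => uflowIsotopy_apply_of_not_mem hV hε hu hVS hx t⟩

end Literature.Topology.FourManifolds
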